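import Summits.QuantumFields.YangMills.Theorems.BalabanUVNodesK0AxTangentSocketDock
import Summits.QuantumFields.YangMills.Theorems.BalabanUVNodesPortS1Selector
import Literature.MathematicalPhysics.QuantumFieldTheory.Balaban1983to89.Node00.BgSchemeOfRecordLie
import HarnessLib

/-!
# NODE O · K0ᴬ — THE INSTANCE-SIDE LETTERS OF THE TANGENT SOCKET ∕ JUNCTION AT def-Y's SCHEME OF RECORD:
# `X := lieExpo ∘ unitField`, (s-exp) from the Lie token, `X 0 = 0`, `ContDiffAt ℝ n X 0`, the `Cⁿ` chart entries (`hC` ∕ `hdiff`), the domain letter — BY NAME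

Cell `pub-ymgap` (YM-PLAN Track A), seat `pub-ymgap-node00-def-Y` (g38; custodian of the `BgScheme` instance of record), `--supports stmt-QuantumFields-27238 --as helper`.
[15] = [Balaban1985Variational], [I] = [Balaban1987RG1].

WHY.  ◆ CRIT-1 g37 (nodeO l.5250) priced the K0 junction ✓`…K0AxJunctionRootGradScheme` (FILE 55: `h1 : S.chartCfg 1 = 1`, `hdiff`∕`hC` = `C¹`∕`C²` chart
matrix entries at `B = 0`, `hdom`) and ▶ PTC-1 g4 ∕ ◇ lens-1 g11 the tangent socket ✓`…K0AxTangentSocket[Dock]` (FILE 56∕5′: a chart family `B ↦ expChart 1 (X B)`,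
(s-exp) `S.chartCfg ∘ unitField =ᶠ[𝓝 0] expChart 1 ∘ X` with the DISPLAYED presentation letter `hX`, `X 0 = 0`, `ContDiffAt ℝ 2 X 0`) as conditional theorems over
a generic `S : BgScheme F 2 𝒴 𝒵 K (k+1)`; the instance-side letters were named def-Y's.  This file supplies them at the scheme of record
`bgSchemeOfRecord F 2 K (k+1) Ω 1 dom …` (Lit ✓`Node00.BgSchemeOfRecord`, flat background `U₀ = 1`) with the canonical Lie field
`X B := S.lieExpo (unitField B)` (Lit ✓`Node00.BgSchemeChartLie`: `lieExpo = π_𝔰𝔲(i·ev(𝒜 + 𝔄))`), from Lit ✓`Node00.BgSchemeOfRecordLie` (flat value, `Cⁿ` along a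
datum map) and the datum-side smoothness of `B ↦ W_B = exp(ρ₈B)` proved here.

WHAT IS PROVED (kernel, sorry-free, standard axioms; namespace `K0AxCtabUniq`, the junction's).
§1 DATUM SIDE (any `θ` with `exp(ρ₈ v) ∈ SU(2)`, e.g. the fill `thetaFill`): `contDiff_coeField_unitField` — `B ↦ (W_B(b))_b` is `C^n` for every `n` (`exp` after the
   continuous linear `ρ₈` after evaluation); `continuous_unitField_of_exp_mem`; `eventually_unitField_mem` — the domain letter `hdom` from `dom ∈ 𝓝 1`; fill editions.
§2 GENERIC SCHEME `S : BgScheme F 2 𝒴 𝒵 K (k+1)`: `coe_lieExpo_unitField_eventually` — the Dock's presentation letter `hX` for `X := lieExpo ∘ unitField` FROM the Lie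
   token `S.LieTokAt` eventually along `unitField` (Lit ✓`BgScheme.coe_lieExpo`); `chartCfg_unitField_eventuallyEq_expChart_lieExpo` — (s-exp) for this `X` from
   {`S.bg ∘ unitField =ᶠ 1`, eventual Lie token} (✓`chartCfg_unitField_eventuallyEq_expChart`); `lieExpo_unitField_zero` — `X 0 = 0` from `𝒜(1) = 0 = 𝔄(1)`.
§3 AT THE SCHEME OF RECORD (`N = 2`, level `k+1`, `U₀ = 1`; binders VERBATIM ✓`Node00.BgSchemeOfRecord`): `bg_unitField_ofRecord` (`rfl`); ★`lieExpo_unitField_zero_ofRecord`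
   — `X 0 = 0` modulo `RegimeTok ∧ 1 ∈ dom` (✓`bgSchemeOfRecord_sol_one`); ★`chartCfg_unitField_eventuallyEq_expChart_ofRecord` — (s-exp) modulo the eventual Lie token ONLY;
   ★★`contDiffAt_lieExpo_unitField_ofRecord` — `ContDiffAt ℝ n X 0` modulo {`RegimeTok`, `1 ∈ dom`, `WAnalyticTok`, `0 < a`} and the datum-side `C^n` letter (discharged at
   any `θ` with `exp ρ₈ ⊆ SU(2)`: `…_of_exp_mem`); ★★`contDiffAt_coe_chartCfg_unitField_ofRecord` ∕ `differentiableAt_coe_chartCfg_unitField_ofRecord` — FILE 55's `hC`∕`hdiff`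
   modulo the same + the eventual Lie token; `chartCfg_one_ofRecord` — FILE 55's `h1` (re-export of ✓`bgSchemeOfRecord_chartCfg_one` at `N = 2`, level `k+1`).

HONEST.  Calculus ∕ by-name glue; CONDITIONAL over DISPLAYED letters inhabited nowhere off the flat datum: `RegimeTok` ((117)-pair + Prop. 4 uniform), `WAnalyticTok`
(Prop. 4 analyticity of `W`), `1 ∈ dom` ∕ `dom ∈ 𝓝 1`, and the Lie token `S.LieTokAt (unitField B)` for `B` near `0` = reality of the fixed point, the output of the
reality-rows programme through Lit ✓`BgScheme.lieTokAt_of_rows` (rows typed N-generically, the `J`-row inhabited at `N = 2` ∕ on the flat orbit — dag-n07-w3 lane); at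
`B = 0` itself the token holds (✓`bgSchemeOfRecord_lieTokAt_one`).  Nothing of [15] (Thm 1, Prop. 4, 6, 9) is asserted, ported or discharged; K0ᴬ stmt-QuantumFields-27238
OPEN — NOTHING of it proved; NODE O 0∕1; COUNT 8∕28 · K 1∕4 UNMOVED; finite 𝕋⁴_{L^K} at fixed ε — NOT continuum ∕ OS ∕ Clay; **the Yang–Mills mass gap is NOT proved by
any of this.**  No `sorry`, no `instance ∕ notation ∕ set_option`; standard axioms.
-/

noncomputable section

open Filter Topology
open scoped Matrix.Norms.L2Operator InnerProductSpace

namespace Summit.QuantumFields.YangMills.Theorems.K0AxCtabUniq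

open Literature.MathematicalPhysics.QuantumFieldTheory.Balaban1983to89
open LatticeFieldCalculus
open Literature.MathematicalPhysics.QuantumFieldTheory.Balaban1983to89.T4Continuum (T4Family)
open Literature.MathematicalPhysics.QuantumFieldTheory.Balaban1983to89.Node00
open T4AdjointCovarianceUnitary (lieSU expSU coe_expSU)
open B11Eq103H1Complex (BondL2K SiteL2K)
open NormedSpace (exp)
open Summit.QuantumFields.YangMills.Theorems.K0RecordFormatNames
open Summit.QuantumFields.YangMills.Theorems.BalabanUVNodesPortS1 (unitField_zero exp_ρ8_thetaFill_mem)

variable (F : T4Family) (θ : Stage13Params F 2)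

/-! ### §1  Datum side: `B ↦ W_B = exp(ρ₈ B)` is smooth; continuity; the domain letter -/

section Datum

/-- **THE CHARTED UNIT-LATTICE FIELD IS `Cⁿ` IN THE COORDINATES** (as the family of its bond matrices): `B ↦ (W_B(b))_b = (exp(ρ₈ B_{μ(b)}(x(b))))_b` — `exp` is
real-analytic on `M₂(ℂ)`, `ρ₈` is continuous linear, evaluation is linear; under the chart letter `exp(ρ₈ v) ∈ SU(2)` the retraction `suOfMat` is invisible.
[cite: Balaban1987RG1, p.264 (before (1.20)), (1.20)–(1.21) p.264] -/
theorem contDiff_coeField_unitField (k K : ℕ) {n : WithTop ℕ∞}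
    (hρ : letI := θ.instVβ₁; letI := θ.instVβ₂; ∀ v : θ.Vβ, exp (θ.ρ8 v) ∈ Matrix.specialUnitaryGroup (Fin 2) ℂ) :
    letI := θ.instVβ₁; letI := θ.instVβ₂
    ContDiff ℝ n (fun B : Fin (F.P K).d → Site (F.P K) (k + 1) → θ.Vβ => coeField (unitField F θ k K B)) := by
  letI := θ.instVβ₁; letI := θ.instVβ₂
  refine contDiff_pi.2 fun b => ?_
  have h : (fun B : Fin (F.P K).d → Site (F.P K) (k + 1) → θ.Vβ => coeField (unitField F θ k K B) b) =
      fun B => exp (θ.ρ8 (B b.dir b.src)) := by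
    funext B
    show ((suOfMat 2 (exp (θ.ρ8 (B b.dir b.src))) : SU 2) : Matrix (Fin 2) (Fin 2) ℂ) = exp (θ.ρ8 (B b.dir b.src))
    rw [suOfMat_of_mem (hρ _)]
  rw [h]
  have hd : ContDiff ℝ n (fun B : Fin (F.P K).d → Site (F.P K) (k + 1) → θ.Vβ => B b.dir) := contDiff_pi.1 contDiff_id b.dir
  have hs : ContDiff ℝ n (fun B : Fin (F.P K).d → Site (F.P K) (k + 1) → θ.Vβ => B b.dir b.src) := contDiff_pi.1 hd b.src
  have hρ8 : ContDiff ℝ n (fun B : Fin (F.P K).d → Site (F.P K) (k + 1) → θ.Vβ => θ.ρ8 (B b.dir b.src)) := θ.ρ8.contDiff.comp hs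
  exact (contDiff_iff_contDiffAt.2 fun A => BgScheme.contDiffAt_exp_matrix A).comp hρ8

/-- The same at a point, the shape the record lemmas consume. [cite: Balaban1987RG1, p.264 (before (1.20)) (bookkeeping)] -/
theorem contDiffAt_coeField_unitField (k K : ℕ) {n : WithTop ℕ∞}
    (hρ : letI := θ.instVβ₁; letI := θ.instVβ₂; ∀ v : θ.Vβ, exp (θ.ρ8 v) ∈ Matrix.specialUnitaryGroup (Fin 2) ℂ)
    (B₀ : Fin (F.P K).d → Site (F.P K) (k + 1) → θ.Vβ) :
    letI := θ.instVβ₁; letI := θ.instVβ₂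
    ContDiffAt ℝ n (fun B : Fin (F.P K).d → Site (F.P K) (k + 1) → θ.Vβ => coeField (unitField F θ k K B)) B₀ := by
  letI := θ.instVβ₁; letI := θ.instVβ₂
  exact (contDiff_coeField_unitField F θ k K hρ).contDiffAt

/-- `B ↦ W_B` is continuous (into `SU(2)`-valued fields) under the chart letter. [cite: Balaban1987RG1, p.264 (before (1.20)) (bookkeeping)] -/
theorem continuous_unitField_of_exp_mem (k K : ℕ)
    (hρ : letI := θ.instVβ₁; letI := θ.instVβ₂; ∀ v : θ.Vβ, exp (θ.ρ8 v) ∈ Matrix.specialUnitaryGroup (Fin 2) ℂ) :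
    letI := θ.instVβ₁; letI := θ.instVβ₂
    Continuous (fun B : Fin (F.P K).d → Site (F.P K) (k + 1) → θ.Vβ => unitField F θ k K B) := by
  letI := θ.instVβ₁; letI := θ.instVβ₂
  have hc := (contDiff_coeField_unitField F θ k K (n := 0) hρ).continuous
  refine continuous_pi fun b => Topology.IsInducing.subtypeVal.continuous_iff.mpr ?_
  exact (continuous_apply b).comp hc

/-- **THE DOMAIN LETTER `hdom`**: if the (7)-domain is a neighbourhood of the unit configuration then `W_B ∈ dom` for `B` near `0` (`W_0 = 1`, continuity).
[cite: Balaban1985Variational, (7) p.278; Balaban1987RG1, p.265] -/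
theorem eventually_unitField_mem (k K : ℕ)
    (hρ : letI := θ.instVβ₁; letI := θ.instVβ₂; ∀ v : θ.Vβ, exp (θ.ρ8 v) ∈ Matrix.specialUnitaryGroup (Fin 2) ℂ)
    {dom : Set (GaugeField (F.P K) (k + 1) (SU 2))} (hd : dom ∈ 𝓝 (1 : GaugeField (F.P K) (k + 1) (SU 2))) :
    letI := θ.instVβ₁; letI := θ.instVβ₂
    ∀ᶠ B in 𝓝 (0 : Fin (F.P K).d → Site (F.P K) (k + 1) → θ.Vβ), unitField F θ k K B ∈ dom := by
  letI := θ.instVβ₁; letI := θ.instVβ₂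
  refine ((continuous_unitField_of_exp_mem F θ k K hρ).continuousAt (x := 0)).eventually_mem ?_
  rwa [unitField_zero F θ k K]

/-- At the fill `θ := thetaFill F a₀ ε₂₉` the chart letter holds (✓`exp_ρ8_thetaFill_mem`): `B ↦ (W_B(b))_b` is `Cⁿ`. [cite: Balaban1987RG1, p.264 (before (1.20))] -/
theorem contDiff_coeField_unitField_thetaFill (a₀ ε₂₉ : ℝ) (k K : ℕ) {n : WithTop ℕ∞} :
    letI θ := thetaFill F a₀ ε₂₉; letI := θ.instVβ₁; letI := θ.instVβ₂
    ContDiff ℝ n (fun B : recordW F a₀ ε₂₉ k K => coeField (unitField F θ k K B)) :=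
  contDiff_coeField_unitField F (thetaFill F a₀ ε₂₉) k K (exp_ρ8_thetaFill_mem F a₀ ε₂₉)

/-- At the fill: the domain letter from `dom ∈ 𝓝 1`. [cite: Balaban1985Variational, (7) p.278 (bookkeeping)] -/
theorem eventually_unitField_mem_thetaFill (a₀ ε₂₉ : ℝ) (k K : ℕ) {dom : Set (GaugeField (F.P K) (k + 1) (SU 2))}
    (hd : dom ∈ 𝓝 (1 : GaugeField (F.P K) (k + 1) (SU 2))) :
    letI θ := thetaFill F a₀ ε₂₉; letI := θ.instVβ₁; letI := θ.instVβ₂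
    ∀ᶠ B in 𝓝 (0 : recordW F a₀ ε₂₉ k K), unitField F θ k K B ∈ dom :=
  eventually_unitField_mem F (thetaFill F a₀ ε₂₉) k K (exp_ρ8_thetaFill_mem F a₀ ε₂₉) hd

end Datum

/-! ### §2  Generic scheme `S : BgScheme F 2 𝒴 𝒵 K (k+1)`: the presentation letter, (s-exp) and `X 0 = 0` for `X := lieExpo ∘ unitField` -/

section GenericScheme

variable {𝒴 𝒵 : Type} [NormedAddCommGroup 𝒴] [NormedSpace ℂ 𝒴] [NormedAddCommGroup 𝒵] [NormedSpace ℂ 𝒵]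

/-- **THE DOCK's PRESENTATION LETTER `hX` FOR `X := lieExpo ∘ unitField`, FROM THE LIE TOKEN** eventually along the charted unit-lattice fields (Lit ✓`BgScheme.coe_lieExpo`:
on the token, `π_𝔰𝔲` is invisible). [cite: Balaban1985Variational, (15) p.280, (19) p.281, Prop. 6 p.295] -/
theorem coe_lieExpo_unitField_eventually (k K : ℕ) (S : BgScheme F 2 𝒴 𝒵 K (k + 1))
    (htok : letI := θ.instVβ₁; letI := θ.instVβ₂;
      ∀ᶠ B in 𝓝 (0 : Fin (F.P K).d → Site (F.P K) (k + 1) → θ.Vβ), S.LieTokAt (unitField F θ k K B)) :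
    letI := θ.instVβ₁; letI := θ.instVβ₂
    ∀ᶠ B in 𝓝 (0 : Fin (F.P K).d → Site (F.P K) (k + 1) → θ.Vβ), ∀ b : PBond (F.P K) 0,
      ((S.lieExpo (unitField F θ k K B) b : lieSU (Fin 2)) : Matrix (Fin 2) (Fin 2) ℂ) =
        Complex.I • S.ev (S.sol (unitField F θ k K B) + S.𝔄 (unitField F θ k K B)) b := by
  letI := θ.instVβ₁; letI := θ.instVβ₂
  exact htok.mono fun B hB b => S.coe_lieExpo hB b

/-- **(s-exp) FOR `X := lieExpo ∘ unitField`**: `S.chartCfg ∘ unitField =ᶠ[𝓝 0] (B ↦ expChart 1 (S.lieExpo (unitField B)))` from the unit background and the Lie token,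
both eventually (✓`chartCfg_unitField_eventuallyEq_expChart` + the presentation letter above). [cite: Balaban1985Variational, (15) p.280, (19) p.281, Prop. 9 p.309] -/
theorem chartCfg_unitField_eventuallyEq_expChart_lieExpo (k K : ℕ) (S : BgScheme F 2 𝒴 𝒵 K (k + 1))
    (hbg : letI := θ.instVβ₁; letI := θ.instVβ₂;
      ∀ᶠ B in 𝓝 (0 : Fin (F.P K).d → Site (F.P K) (k + 1) → θ.Vβ), S.bg (unitField F θ k K B) = 1)
    (htok : letI := θ.instVβ₁; letI := θ.instVβ₂;
      ∀ᶠ B in 𝓝 (0 : Fin (F.P K).d → Site (F.P K) (k + 1) → θ.Vβ), S.LieTokAt (unitField F θ k K B)) :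
    letI := θ.instVβ₁; letI := θ.instVβ₂
    (fun B => S.chartCfg (unitField F θ k K B)) =ᶠ[𝓝 (0 : Fin (F.P K).d → Site (F.P K) (k + 1) → θ.Vβ)]
      fun B => expChart (1 : GaugeField (F.P K) 0 (SU 2)) (S.lieExpo (unitField F θ k K B)) := by
  letI := θ.instVβ₁; letI := θ.instVβ₂
  exact chartCfg_unitField_eventuallyEq_expChart F θ k K S (fun B => S.lieExpo (unitField F θ k K B)) hbg
    (coe_lieExpo_unitField_eventually F θ k K S htok)

/-- **`X 0 = 0`** for `X := lieExpo ∘ unitField`: `W_0 = 1` (✓`unitField_zero`) and the exponent vanishes where `𝒜(1) = 0 = 𝔄(1)` (Lit ✓`BgScheme.lieExpo_eq_zero`).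
[cite: Balaban1985Variational, (15) p.280, Prop. 9 p.309; Balaban1987RG1, p.264] -/
theorem lieExpo_unitField_zero (k K : ℕ) (S : BgScheme F 2 𝒴 𝒵 K (k + 1))
    (hsol : S.sol 1 = 0) (h𝔄 : S.𝔄 1 = 0) :
    letI := θ.instVβ₁; letI := θ.instVβ₂
    S.lieExpo (unitField F θ k K (0 : Fin (F.P K).d → Site (F.P K) (k + 1) → θ.Vβ)) = 0 := by
  letI := θ.instVβ₁; letI := θ.instVβ₂
  rw [unitField_zero F θ k K]
  exact S.lieExpo_eq_zero hsol h𝔄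

end GenericScheme

/-! ### §3  At def-Y's scheme of record: `N = 2`, level `k+1`, flat background `U₀ = 1` -/

section OfRecord

variable (K k : ℕ) (Ω : ℕ → Set (Site (F.P K) 0))
variable [Fact (0 < (F.L : ℝ))] [Fact (0 < (F.P K).eta (k + 1))] [Fact (0 < c0Rec F K (k + 1))] [Fact (∀ c, 0 < wBRec F K (k + 1) c)]
variable (dom : Set (GaugeField (F.P K) (k + 1) (SU 2))) (levB : PBond (F.P K) (k + 1) → ℕ)
  (Gp : SiteL2K ℂ (F.P K).d (fun _ => (F.P K).sitesPerDir 0) (c0Rec F K (k + 1)) (WRec 2) →ₗ[ℂ]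
    SiteL2K ℂ (F.P K).d (fun _ => (F.P K).sitesPerDir 0) (c0Rec F K (k + 1)) (WRec 2))
  (Δ2 : BondL2K ℂ (F.P K).d (fun _ => (F.P K).sitesPerDir 0) (c0Rec F K (k + 1)) (WRec 2) →ₗ[ℂ]
    BondL2K ℂ (F.P K).d (fun _ => (F.P K).sitesPerDir 0) (c0Rec F K (k + 1)) (WRec 2)) (a : ℝ)
  (hposπ : ∀ x, x ≠ 0 → 0 < RCLike.re ⟪x, laplaceAOfRecordAt F 2 (k + 1) (1 : GaugeField (F.P K) 0 (SU 2))
    (hessOpOfRecord128 F 2 (k + 1) (1 : GaugeField (F.P K) 0 (SU 2)) Gp (QflatOfRecord F 2 (k + 1)) Δ2)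
    (QOfRecord F 2 (k + 1) (1 : GaugeField (F.P K) 0 (SU 2))) (QflatOfRecord F 2 (k + 1)) a x⟫_ℂ)
  (hposb : ∀ x, x ≠ 0 → 0 < RCLike.re ⟪x, laplaceAOfRecord F 2 (k + 1) (1 : GaugeField (F.P K) 0 (SU 2))
    (QOfRecord F 2 (k + 1) (1 : GaugeField (F.P K) 0 (SU 2))) (QflatOfRecord F 2 (k + 1)) a x⟫_ℂ)
  (hQ : Function.Surjective (QOfRecord F 2 (k + 1) (1 : GaugeField (F.P K) 0 (SU 2)))) (εC B₀ C₄ a₃ j a𝔄 ε₄ : ℝ)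

/-- The background of the scheme of record at `U₀ = 1` is the unit along every charted field (`rfl`) — the Dock's `hbg`. [cite: Balaban1985Variational, (19) p.281 (bookkeeping)] -/
theorem bg_unitField_ofRecord (B : Fin (F.P K).d → Site (F.P K) (k + 1) → θ.Vβ) :
    letI := θ.instVβ₁; letI := θ.instVβ₂
    (bgSchemeOfRecord F 2 K (k + 1) Ω 1 dom levB Gp Δ2 a hposπ hposb hQ εC B₀ C₄ a₃ j a𝔄 ε₄).bg (unitField F θ k K B) = 1 :=
  rfl

/-- **FILE 55's `h1` at the scheme of record** (`N = 2`, level `k+1`): `chartCfg 1 = 1` modulo `RegimeTok ∧ 1 ∈ dom` (Lit ✓`bgSchemeOfRecord_chartCfg_one`).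
[cite: Balaban1985Variational, (15) p.280, Prop. 9 p.309] -/
theorem chartCfg_one_ofRecord
    (hT : (bgSchemeOfRecord F 2 K (k + 1) Ω 1 dom levB Gp Δ2 a hposπ hposb hQ εC B₀ C₄ a₃ j a𝔄 ε₄).RegimeTok)
    (h1 : (1 : GaugeField (F.P K) (k + 1) (SU 2)) ∈ dom) :
    (bgSchemeOfRecord F 2 K (k + 1) Ω 1 dom levB Gp Δ2 a hposπ hposb hQ εC B₀ C₄ a₃ j a𝔄 ε₄).chartCfg 1 = 1 :=
  bgSchemeOfRecord_chartCfg_one F 2 K (k + 1) Ω dom levB Gp Δ2 a hposπ hposb hQ εC B₀ C₄ a₃ j a𝔄 ε₄ hT h1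

/-- ★ **`X 0 = 0` AT THE SCHEME OF RECORD** for `X := lieExpo ∘ unitField`, modulo `RegimeTok ∧ 1 ∈ dom` (✓`bgSchemeOfRecord_sol_one`, ✓`bgSchemeOfRecord_𝔄_one`).
[cite: Balaban1985Variational, (15) p.280, Prop. 6 (116) p.295, Prop. 9 p.309] -/
theorem lieExpo_unitField_zero_ofRecord
    (hT : (bgSchemeOfRecord F 2 K (k + 1) Ω 1 dom levB Gp Δ2 a hposπ hposb hQ εC B₀ C₄ a₃ j a𝔄 ε₄).RegimeTok)
    (h1 : (1 : GaugeField (F.P K) (k + 1) (SU 2)) ∈ dom) :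
    letI := θ.instVβ₁; letI := θ.instVβ₂
    (bgSchemeOfRecord F 2 K (k + 1) Ω 1 dom levB Gp Δ2 a hposπ hposb hQ εC B₀ C₄ a₃ j a𝔄 ε₄).lieExpo
      (unitField F θ k K (0 : Fin (F.P K).d → Site (F.P K) (k + 1) → θ.Vβ)) = 0 := by
  letI := θ.instVβ₁; letI := θ.instVβ₂
  exact lieExpo_unitField_zero F θ k K _
    (bgSchemeOfRecord_sol_one F 2 K (k + 1) Ω dom levB Gp Δ2 a hposπ hposb hQ εC B₀ C₄ a₃ j a𝔄 ε₄ hT h1)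
    (bgSchemeOfRecord_𝔄_one F 2 K (k + 1) Ω dom levB Gp Δ2 a hposπ hposb hQ εC B₀ C₄ a₃ j a𝔄 ε₄)

/-- ★ **(s-exp) AT THE SCHEME OF RECORD** for `X := lieExpo ∘ unitField`, modulo the eventual Lie token ONLY (the background letter is `rfl`).
[cite: Balaban1985Variational, (15) p.280, (19) p.281, Prop. 9 p.309] -/
theorem chartCfg_unitField_eventuallyEq_expChart_ofRecord
    (htok : letI := θ.instVβ₁; letI := θ.instVβ₂;
      ∀ᶠ B in 𝓝 (0 : Fin (F.P K).d → Site (F.P K) (k + 1) → θ.Vβ),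
        (bgSchemeOfRecord F 2 K (k + 1) Ω 1 dom levB Gp Δ2 a hposπ hposb hQ εC B₀ C₄ a₃ j a𝔄 ε₄).LieTokAt (unitField F θ k K B)) :
    letI := θ.instVβ₁; letI := θ.instVβ₂
    (fun B => (bgSchemeOfRecord F 2 K (k + 1) Ω 1 dom levB Gp Δ2 a hposπ hposb hQ εC B₀ C₄ a₃ j a𝔄 ε₄).chartCfg (unitField F θ k K B))
      =ᶠ[𝓝 (0 : Fin (F.P K).d → Site (F.P K) (k + 1) → θ.Vβ)]
      fun B => expChart (1 : GaugeField (F.P K) 0 (SU 2))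
        ((bgSchemeOfRecord F 2 K (k + 1) Ω 1 dom levB Gp Δ2 a hposπ hposb hQ εC B₀ C₄ a₃ j a𝔄 ε₄).lieExpo (unitField F θ k K B)) := by
  letI := θ.instVβ₁; letI := θ.instVβ₂
  exact chartCfg_unitField_eventuallyEq_expChart_lieExpo F θ k K _ (Eventually.of_forall fun B => rfl) htok

/-- ★★ **`ContDiffAt ℝ n X 0` AT THE SCHEME OF RECORD** for `X := lieExpo ∘ unitField` (the socket's `ContDiffAt ℝ 2 X 0` ∕ `DifferentiableAt ℝ X 0`), modulo the DISPLAYED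
`RegimeTok`, `1 ∈ dom`, `WAnalyticTok`, `0 < a`, and the datum-side `Cⁿ` letter (✓`bgSchemeOfRecord_contDiffAt_lieExpo_comp` at the flat datum `coeField 1 ∈ logPolydiscOfRecord`).
[cite: Balaban1985Variational, Prop. 9 p.309, Prop. 6 (116)–(121) p.295, Prop. 4 p.292, (15) p.280] -/
theorem contDiffAt_lieExpo_unitField_ofRecord {n : WithTop ℕ∞}
    (hT : (bgSchemeOfRecord F 2 K (k + 1) Ω 1 dom levB Gp Δ2 a hposπ hposb hQ εC B₀ C₄ a₃ j a𝔄 ε₄).RegimeTok)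
    (h1 : (1 : GaugeField (F.P K) (k + 1) (SU 2)) ∈ dom) (hW : WAnalyticTok F 2 K (k + 1) Ω 1 levB Gp a hposb hQ εC a₃) (ha : 0 < a𝔄)
    (hu : letI := θ.instVβ₁; letI := θ.instVβ₂;
      ContDiffAt ℝ n (fun B : Fin (F.P K).d → Site (F.P K) (k + 1) → θ.Vβ => coeField (unitField F θ k K B)) 0) :
    letI := θ.instVβ₁; letI := θ.instVβ₂
    ContDiffAt ℝ n (fun B : Fin (F.P K).d → Site (F.P K) (k + 1) → θ.Vβ =>
      (bgSchemeOfRecord F 2 K (k + 1) Ω 1 dom levB Gp Δ2 a hposπ hposb hQ εC B₀ C₄ a₃ j a𝔄 ε₄).lieExpo (unitField F θ k K B)) 0 := by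
  letI := θ.instVβ₁; letI := θ.instVβ₂
  refine bgSchemeOfRecord_contDiffAt_lieExpo_comp F 2 K (k + 1) Ω 1 dom levB Gp Δ2 a hposπ hposb hQ εC B₀ C₄ a₃ j a𝔄 ε₄ hT h1 hW hu ?_
  show coeField (unitField F θ k K (0 : Fin (F.P K).d → Site (F.P K) (k + 1) → θ.Vβ)) ∈ _
  rw [unitField_zero F θ k K]
  exact coeField_one_mem_logPolydiscOfRecord F 2 K (k + 1) Ω levB Gp Δ2 a hposπ hQ a𝔄 ha

/-- The same with the datum-side letter DISCHARGED under the chart letter `exp(ρ₈ v) ∈ SU(2)` (§1). [cite: Balaban1985Variational, Prop. 9 p.309; Balaban1987RG1, p.264] -/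
theorem contDiffAt_lieExpo_unitField_ofRecord_of_exp_mem {n : WithTop ℕ∞}
    (hρ : letI := θ.instVβ₁; letI := θ.instVβ₂; ∀ v : θ.Vβ, exp (θ.ρ8 v) ∈ Matrix.specialUnitaryGroup (Fin 2) ℂ)
    (hT : (bgSchemeOfRecord F 2 K (k + 1) Ω 1 dom levB Gp Δ2 a hposπ hposb hQ εC B₀ C₄ a₃ j a𝔄 ε₄).RegimeTok)
    (h1 : (1 : GaugeField (F.P K) (k + 1) (SU 2)) ∈ dom) (hW : WAnalyticTok F 2 K (k + 1) Ω 1 levB Gp a hposb hQ εC a₃) (ha : 0 < a𝔄) :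
    letI := θ.instVβ₁; letI := θ.instVβ₂
    ContDiffAt ℝ n (fun B : Fin (F.P K).d → Site (F.P K) (k + 1) → θ.Vβ =>
      (bgSchemeOfRecord F 2 K (k + 1) Ω 1 dom levB Gp Δ2 a hposπ hposb hQ εC B₀ C₄ a₃ j a𝔄 ε₄).lieExpo (unitField F θ k K B)) 0 := by
  letI := θ.instVβ₁; letI := θ.instVβ₂
  exact contDiffAt_lieExpo_unitField_ofRecord F θ K k Ω dom levB Gp Δ2 a hposπ hposb hQ εC B₀ C₄ a₃ j a𝔄 ε₄ hT h1 hW ha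
    (contDiffAt_coeField_unitField F θ k K hρ 0)

/-- ★★ **FILE 55's `hC` (`n = 2`) ∕ `hdiff` (`n = 1`) AT THE SCHEME OF RECORD**: the chart matrix entries `B ↦ ((chartCfg (W_B))(b))_b` are `Cⁿ` at `B = 0`, modulo the DISPLAYED
`RegimeTok`, `1 ∈ dom`, `WAnalyticTok`, `0 < a`, the datum-side `Cⁿ` letter and the eventual Lie token (✓`bgSchemeOfRecord_contDiffAt_coe_chartCfg_comp_pi`).
[cite: Balaban1985Variational, Prop. 9 p.309, (15) p.280, (19) p.281] -/
theorem contDiffAt_coe_chartCfg_unitField_ofRecord {n : WithTop ℕ∞}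
    (hT : (bgSchemeOfRecord F 2 K (k + 1) Ω 1 dom levB Gp Δ2 a hposπ hposb hQ εC B₀ C₄ a₃ j a𝔄 ε₄).RegimeTok)
    (h1 : (1 : GaugeField (F.P K) (k + 1) (SU 2)) ∈ dom) (hW : WAnalyticTok F 2 K (k + 1) Ω 1 levB Gp a hposb hQ εC a₃) (ha : 0 < a𝔄)
    (hu : letI := θ.instVβ₁; letI := θ.instVβ₂;
      ContDiffAt ℝ n (fun B : Fin (F.P K).d → Site (F.P K) (k + 1) → θ.Vβ => coeField (unitField F θ k K B)) 0)
    (htok : letI := θ.instVβ₁; letI := θ.instVβ₂;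
      ∀ᶠ B in 𝓝 (0 : Fin (F.P K).d → Site (F.P K) (k + 1) → θ.Vβ),
        (bgSchemeOfRecord F 2 K (k + 1) Ω 1 dom levB Gp Δ2 a hposπ hposb hQ εC B₀ C₄ a₃ j a𝔄 ε₄).LieTokAt (unitField F θ k K B)) :
    letI := θ.instVβ₁; letI := θ.instVβ₂
    ContDiffAt ℝ n (fun (B : Fin (F.P K).d → Site (F.P K) (k + 1) → θ.Vβ) (b : PBond (F.P K) 0) =>
      (((bgSchemeOfRecord F 2 K (k + 1) Ω 1 dom levB Gp Δ2 a hposπ hposb hQ εC B₀ C₄ a₃ j a𝔄 ε₄).chartCfg (unitField F θ k K B) b : SU 2) :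
        Matrix (Fin 2) (Fin 2) ℂ)) 0 := by
  letI := θ.instVβ₁; letI := θ.instVβ₂
  refine bgSchemeOfRecord_contDiffAt_coe_chartCfg_comp_pi F 2 K (k + 1) Ω 1 dom levB Gp Δ2 a hposπ hposb hQ εC B₀ C₄ a₃ j a𝔄 ε₄ hT h1 hW hu ?_ htok
  show coeField (unitField F θ k K (0 : Fin (F.P K).d → Site (F.P K) (k + 1) → θ.Vβ)) ∈ _
  rw [unitField_zero F θ k K]
  exact coeField_one_mem_logPolydiscOfRecord F 2 K (k + 1) Ω levB Gp Δ2 a hposπ hQ a𝔄 ha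

/-- **FILE 55's `hdiff` VERBATIM** (per bond, `DifferentiableAt`), from the `n = 1` case. [cite: Balaban1985Variational, Prop. 9 p.309 (bookkeeping)] -/
theorem differentiableAt_coe_chartCfg_unitField_ofRecord
    (hT : (bgSchemeOfRecord F 2 K (k + 1) Ω 1 dom levB Gp Δ2 a hposπ hposb hQ εC B₀ C₄ a₃ j a𝔄 ε₄).RegimeTok)
    (h1 : (1 : GaugeField (F.P K) (k + 1) (SU 2)) ∈ dom) (hW : WAnalyticTok F 2 K (k + 1) Ω 1 levB Gp a hposb hQ εC a₃) (ha : 0 < a𝔄)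
    (hu : letI := θ.instVβ₁; letI := θ.instVβ₂;
      ContDiffAt ℝ 1 (fun B : Fin (F.P K).d → Site (F.P K) (k + 1) → θ.Vβ => coeField (unitField F θ k K B)) 0)
    (htok : letI := θ.instVβ₁; letI := θ.instVβ₂;
      ∀ᶠ B in 𝓝 (0 : Fin (F.P K).d → Site (F.P K) (k + 1) → θ.Vβ),
        (bgSchemeOfRecord F 2 K (k + 1) Ω 1 dom levB Gp Δ2 a hposπ hposb hQ εC B₀ C₄ a₃ j a𝔄 ε₄).LieTokAt (unitField F θ k K B))
    (b : PBond (F.P K) 0) :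
    letI := θ.instVβ₁; letI := θ.instVβ₂
    DifferentiableAt ℝ (fun B : Fin (F.P K).d → Site (F.P K) (k + 1) → θ.Vβ =>
      (((bgSchemeOfRecord F 2 K (k + 1) Ω 1 dom levB Gp Δ2 a hposπ hposb hQ εC B₀ C₄ a₃ j a𝔄 ε₄).chartCfg (unitField F θ k K B) b : SU 2) :
        MatA 2)) 0 := by
  letI := θ.instVβ₁; letI := θ.instVβ₂
  have h := contDiffAt_coe_chartCfg_unitField_ofRecord F θ K k Ω dom levB Gp Δ2 a hposπ hposb hQ εC B₀ C₄ a₃ j a𝔄 ε₄ hT h1 hW ha hu htok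
  exact (contDiffAt_pi.1 h b).differentiableAt one_ne_zero

/-- The Lie token holds AT `B = 0` at the scheme of record (zero exponent) — the flat inhabitant of the displayed eventual token. [cite: Balaban1985Variational, (15) p.280, Prop. 9 p.309] -/
theorem lieTokAt_unitField_zero_ofRecord
    (hT : (bgSchemeOfRecord F 2 K (k + 1) Ω 1 dom levB Gp Δ2 a hposπ hposb hQ εC B₀ C₄ a₃ j a𝔄 ε₄).RegimeTok)
    (h1 : (1 : GaugeField (F.P K) (k + 1) (SU 2)) ∈ dom) :
    letI := θ.instVβ₁; letI := θ.instVβ₂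
    (bgSchemeOfRecord F 2 K (k + 1) Ω 1 dom levB Gp Δ2 a hposπ hposb hQ εC B₀ C₄ a₃ j a𝔄 ε₄).LieTokAt
      (unitField F θ k K (0 : Fin (F.P K).d → Site (F.P K) (k + 1) → θ.Vβ)) := by
  letI := θ.instVβ₁; letI := θ.instVβ₂
  rw [unitField_zero F θ k K]
  exact bgSchemeOfRecord_lieTokAt_one F 2 K (k + 1) Ω dom levB Gp Δ2 a hposπ hposb hQ εC B₀ C₄ a₃ j a𝔄 ε₄ hT h1

end OfRecord

end Summit.QuantumFields.YangMills.Theorems.K0AxCtabUniq
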